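import Summits.AtomisticToContinuum.HydrodynamicLimit.Theorems.BoxDissipativeWeakStrongFluxClosureDominatedInMeasure
import Summits.AtomisticToContinuum.HydrodynamicLimit.Theorems.BoxDissipativeWeakStrongFluxClosureOfParts
import Summits.AtomisticToContinuum.HydrodynamicLimit.Theorems.BoxDissipativeWeakStrongFluxClosureCollisionalVirialTight
import Summits.AtomisticToContinuum.HydrodynamicLimit.Theorems.BoxDissipativeWeakStrongFluxClosureKineticIsotropyTight
import HarnessLib

/-!
# Crux `FluxClosure` (stmt-AtomisticToContinuum-9902, route BoxDissipativeWeakStrong), line `registered`: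
# the kinetic deviation tends to `0` in `L¹(P_N)` as soon as it tends to `0` in `P_N`-probability (wave-2 piece W2a)

Support file (`--supports stmt-AtomisticToContinuum-9902`) of the lead prover of the crux
`Summit.AtomisticToContinuum.HydrodynamicLimit.Theses.BoxDissipativeWeakStrong.FluxClosure`. It proves the
registered FORMAT LEMMA `kineticIsotropy_of_inProbability` for the open kinetic stub K (`stub_kineticIsotropy`,
stated in `L¹(P_N)`): in the crux's vocabulary (cube kernel `K`, box fields `Dn, Mm, En`, box kinetic stress `Sk`,
box temperature `Th`), for ANY profile functions whose local Gibbs laws `P_N` are probability measures under which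
the kinetic energy per particle `e_N(z) = (N+1)⁻¹ Σ_a ‖v_a‖²` has a second moment bounded uniformly in `N`
(`∫⁻ ofReal (e_N²) dP_N ≤ ofReal C₂`), every flow family, every window `0 < ℓ_N ≤ 1`, every `τ ∈ [0, T)` and every
`w` smooth on `[0,T) × 𝕋³`:

  `KinDev_N → 0` in `P_N`-probability  ⟹  `∫⁻ |KinDev_N| dP_N → 0`,

`KinDev_N(z) = ∫_0^τ∫ Σ_ij (Sk − m̂⊗m̂/ρ̂ − δ ρ̂θ̂)_ij ∂_jw_i`. Proof: the landed abstract upgrade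
`FluxClosureUI.tendsto_lintegral_abs_of_dominated_inMeasure` (energy-dominated convergence in probability implies
`L¹` convergence) with `X_N := KinDev_N`, `e_N` the kinetic energy per particle and `B := 19 C τ`, where `C` bounds
`|∂_jw_i|` on `[0, τ] × 𝕋³` (`FluxClosureK.exists_forall_abs_partialDeriv_le_slab`): the domination
`|KinDev_N| ≤ τ · 19 C e_N ≤ B (1 + e_N)` holds on the good set (`FluxClosureVT.abs_kinDev_le`, energy
conservation), which carries `P_N` (`EntropyClockDock.ae_mem_good_localGibbsLaw`); `KinDev_N` is
`P_N`-a.e.-measurable (`FluxClosureB5.stub_kinDevAEMeasurable`) and `e_N` is measurable (a finite sum of squared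
norms of coordinates). No definitions. References: H. Spohn, *Large Scale Dynamics of Interacting Particles*
(1991), Part I §3.2–3.3.
-/

noncomputable section

namespace Summit.AtomisticToContinuum.HydrodynamicLimit.Theorems
namespace FluxClosureFmt.W2a

open scoped BigOperators Topology Classical MeasureTheory ProbabilityTheory InnerProductSpace ENNReal
open Filter Set Function MeasureTheory
open Literature.MathematicalPhysics.KineticTheory Literature.Analysis.FluidPDE Literature.Analysis.FunctionSpaces
open Summit.AtomisticToContinuum.HydrodynamicLimit.Theses.BoxDissipativeWeakStrong
open Summit.AtomisticToContinuum.HydrodynamicLimit.Theorems.EntropyClockDock (ae_mem_good_localGibbsLaw)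

/-- The kinetic energy per particle `z ↦ (N+1)⁻¹ Σ_a ‖v_a‖²` is measurable on phase space (finite sum of squared
norms of the velocity coordinates). -/
theorem W2a_measurable_energyPerParticle (N : ℕ) :
    Measurable fun z : Config (N + 1) (Fin 3) T3 => (((N + 1 : ℕ) : ℝ))⁻¹ * ∑ a, ‖(z a).2‖ ^ 2 :=
  measurable_const.mul (Finset.measurable_sum _ fun i _ => ((measurable_pi_apply i).snd).norm.pow_const 2)

/-- Elementary rearrangement of the pathwise domination: `τ (19 C e) ≤ (19 C τ) (1 + e)` for `0 ≤ 19 C τ`. -/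
theorem W2a_dom_rearrange {C τ e : ℝ} (h : 0 ≤ 19 * C * τ) :
    τ * (19 * C * e) ≤ 19 * C * τ * (1 + e) := by
  nlinarith [h]

/-- **`K` in `L¹(P_N)` from `K` in `P_N`-probability (wave-2 format lemma W2a of crux `FluxClosure`).** In the
crux's vocabulary: for every `σ`, profile functions `a₀, θ₀, u₀`, constants `C₂ ≥ 0` and `T`, flow family `Φ`
and windows `0 < ℓ_N ≤ 1`, if every local Gibbs law `P_N = localGibbsLaw σ a₀ u₀ θ₀ N (Φ N)` is a probability
measure with `∫⁻ ofReal (e_N²) dP_N ≤ ofReal C₂` (`e_N = (N+1)⁻¹Σ_a‖v_a‖²`), then for every `τ ∈ [0,T)` and every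
`w` smooth on `[0,T) × 𝕋³`: `P_N {δ < |KinDev_N|} → 0` for all `δ > 0` implies `∫⁻ ofReal |KinDev_N| dP_N → 0`.
Proof: `FluxClosureUI.tendsto_lintegral_abs_of_dominated_inMeasure` with `X_N := KinDev_N`, `e_N`, `B := 19 C τ`
(`C` from `FluxClosureK.exists_forall_abs_partialDeriv_le_slab`), the domination `|KinDev_N| ≤ τ · 19 C e_N` on
the good set (`FluxClosureVT.abs_kinDev_le`, `P_N`-a.e. by `ae_mem_good_localGibbsLaw`), a.e.-measurability of
`KinDev_N` (`FluxClosureB5.stub_kinDevAEMeasurable`) and measurability of `e_N`. -/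
theorem kineticIsotropy_of_inProbability : ∀ (σ : ℝ) (a₀ θ₀ : T3 → ℝ) (u₀ : T3 → V3) (C₂ T : ℝ) (Φ : (N : ℕ) → HardSphereFlow (Torus.geometry (Fin 3)) (hsDiameter σ N) (N + 1)) (ℓ : ℕ → ℝ), (∀ N, 0 < ℓ N ∧ ℓ N ≤ 1) → 0 ≤ C₂ → (∀ N, IsProbabilityMeasure (localGibbsLaw σ a₀ u₀ θ₀ N (Φ N))) → (∀ N, ∫⁻ z, ENNReal.ofReal (((((N + 1 : ℕ) : ℝ))⁻¹ * ∑ a, ‖(z a).2‖ ^ 2) ^ 2) ∂(localGibbsLaw σ a₀ u₀ θ₀ N (Φ N)) ≤ ENNReal.ofReal C₂) → let K := fun (l : ℝ) (x y : T3) => indicator {y' : T3 | ∀ i, ‖y' i - x i‖ < l / 2} (fun _ => (l ^ 3)⁻¹) y; let Dn := fun N t z x => empiricalDensityField ((Φ N).flow t z) (K (ℓ N) x); let Mm := fun N t z x => empiricalMomentumField ((Φ N).flow t z) (K (ℓ N) x); let En := fun N t z x => empiricalEnergyField ((Φ N).flow t z) (K (ℓ N) x); let Sk := fun N t z x (i j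 : Fin 3) => ∫ y, K (ℓ N) x y.1 * (y.2 i * y.2 j) ∂(empiricalMeasure ((Φ N).flow t z)); let Th := fun (r : ℝ) (m : V3) (E : ℝ) => 2 / 3 * (E / r - ‖m‖ ^ 2 / (2 * r ^ 2)); ∀ τ ∈ Ico 0 T, ∀ w : ℝ → T3 → V3, Torus.IsSmoothSpaceTimeOn (Ico 0 T) w → (∀ δ : ℝ, 0 < δ → Tendsto (fun N : ℕ => localGibbsLaw σ a₀ u₀ θ₀ N (Φ N) {z | δ < |∫ t in Ioc 0 τ, ∫ x, ∑ i, ∑ j, (Sk N t z x i j - Mm N t z x i * Mm N t z x j / Dn N t z x - (if i = j then Dn N t z x * Th (Dn N t z x) (Mm N t z x) (En N t z x) else 0)) * Torus.partialDeriv j (fun y => w t y i) x|}) atTop (𝓝 0)) → Tendsto (fun N : ℕ => ∫⁻ z, ENNReal.ofReal (|∫ t in Ioc 0 τ, ∫ x, ∑ i, ∑ j, (Sk N t z x i j - Mm N t z x i * Mm N t z x j / Dn N t z x - (if i = j then Dn N t z x * Th (Dn N t z x) (Mm N t z x) (En N t z x) else 0)) * Torus.partialDeriv j (fun y => w t y i)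 x|) ∂(localGibbsLaw σ a₀ u₀ θ₀ N (Φ N))) atTop (𝓝 0) := by
  intro σ a₀ θ₀ u₀ C₂ T Φ ℓ hℓ hC₂ hP he2
  dsimp only
  intro τ hτ w hw hprob
  -- a uniform bound `C` for `|∂_j w_i|` on `[0, τ] × 𝕋³`
  obtain ⟨C, hC0, hC⟩ := FluxClosureK.exists_forall_abs_partialDeriv_le_slab hτ.2 hw
  have h19 : 0 ≤ 19 * C * τ := by have := hτ.1; positivity
  -- pathwise domination on the good set
  have hK := FluxClosureVT.abs_kinDev_le (fun N => hsDiameter σ N) T Φ ℓ hℓ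
  dsimp only at hK
  have hKN := hK τ hτ w C hC
  -- a.e.-measurability of the kinetic deviation
  have h5 := FluxClosureB5.stub_kinDevAEMeasurable σ T a₀ θ₀ u₀ Φ ℓ
  dsimp only at h5
  have h5N := h5 τ hτ w hw
  haveI : ∀ N, IsProbabilityMeasure (localGibbsLaw σ a₀ u₀ θ₀ N (Φ N)) := hP
  refine FluxClosureUI.tendsto_lintegral_abs_of_dominated_inMeasure
    (fun N => localGibbsLaw σ a₀ u₀ θ₀ N (Φ N)) _
    (fun N (z : Config (N + 1) (Fin 3) T3) => (((N + 1 : ℕ) : ℝ))⁻¹ * ∑ a, ‖(z a).2‖ ^ 2)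
    (19 * C * τ) C₂ h19 hC₂ h5N (fun N => (W2a_measurable_energyPerParticle N).aemeasurable)
    (fun N => ae_of_all _ fun z => by positivity) (fun N => ?_) he2 hprob
  filter_upwards [ae_mem_good_localGibbsLaw σ a₀ θ₀ u₀ N (Φ N)] with z hz
  exact (hKN N z hz).trans (W2a_dom_rearrange h19)

end FluxClosureFmt.W2a
end Summit.AtomisticToContinuum.HydrodynamicLimit.Theorems

end
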